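/-
Copyright (c) 2026 the pub-hodgecm-mathlib formalisation cell (harness21).  Prover seat hodgecm-mathlib-F0P3a-p02 (g18): road «S3-ram» (LEAD F0P3a-plan (g13);
architect A-p16 (g32); junction pen F0P3a-p01 (g17), J-PACK v2 (f) isoceles wave), HYP-PLAN v1 (F0P3a-p04 (g19)) node (V3′) «ADAPTED REGDIR COUNTS»; 2026-09-02.
-/
import Literature.NumberTheory.Automorphic.UnitaryLatticeTreeRegionDirectionCountRamified       -- ★ (V3)(i) p848416 ∕ ED. 2 p848447 (LH4-p02): `ncard_adj_regDir_eq_two∕_eq_one`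
import Literature.NumberTheory.Automorphic.UnitaryLatticeTreeIsocelesRegionCriterionRamified      -- ★ p847753 (F0P3-p03): REGION CRITERION
import Literature.NumberTheory.Automorphic.UnitaryLatticeTreeIsocelesRegionLinesRamified          -- ★ p847884∕p848140 (F0P3-p03): `v_lt_one_iff_v_le_v`
import Literature.NumberTheory.Automorphic.UnitaryLatticeTreeIsocelesAdaptedFrameRamified         -- ★ (V0) p848308 (F0P3a-p04): `map_antidiagonal_three_over_apply_eq`
import Literature.NumberTheory.Automorphic.UnitaryLatticeTreeBlockGluing                         -- ★ `v_pairing_comm_of_hermitian`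
import Literature.NumberTheory.Automorphic.UnitaryLatticeTreeApartment                           -- ★ `pairing_mulVec_mulVec_of_mem_unitary`
import HarnessLib

/-!
# The lattice graph of a hermitian space — the NUMBER OF REGION DIRECTIONS at an adapted isoceles region vertex: `2` (root∕interior), `1` (END) (HYP-PLAN node (V3′))

Topic `NumberTheory/Automorphic`; namespace `Literature.NumberTheory.Automorphic.UnitaryLatticeTree`.  THEOREMS ONLY (no definition, no instance, no notation, no named fact,
no `sorry`); kernel lane `--supports stmt-HodgeConjecture-24833`.  Cell `pub/hodgecm-mathlib` (D-0151), crux H413; road «S3-ram» (count-neutral), P-1-ram organ A′ (ii) (a2),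
ISO sockets S45 v4 :46 `row_S45_hyperbolic`, HYP-PLAN v1 (`F0/P3a/F0P3a-p04/g19/hyp/HYP-PLAN.v1.F0P3ap04g19.md` 94da2402): the DISCHARGE of ★ (V3)(i) ED. 2's K-level
hypotheses from the ADAPTED-FRAME data of a region vertex `v = u·r₀` (`|⟨A e_{i₀}, u e₀⟩| < 1`, ★ (V0)): the integral test vectors are `y₁ = u⁻¹(A e_{i₀})` (unit Gram
`κ₀ d_{i₀}`: anisotropic) and `y₂ = u⁻¹(ϖ^{s'} A e_k)`; at a NON-END vertex (`ϖ^{s'−1}A e_k ∈ v`) `ȳ₂ = 0` and `e₀` is an isotropic vector `⊥ ȳ₁`, so TWO children are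
region directions; at an END vertex `y₂` is primitive, isotropic to first order (`|⟨y₂,y₂⟩| = |ϖ|^{2s'}`) and `⊥ y₁` (diagonal Gram), so ONE child is.  Consumers: (V3)(iv) layer
assembly (F0P3-p03), (V5) head assembly (this seat) — the `hRD` hypotheses of ★-filed `HyperbolicJunction.lineCounts_of_not_end∕_of_end`.
HONEST LABEL: HC_CM is proved only modulo the 2 remaining named inputs (hLiu418 24832, h413 24833) until rung 0 closes; nothing printed is asserted here (lattice
bookkeeping over ★ results); «S3-ram» is Literature seeding, count-neutral.

## References
* [Kottwitz1986] R. E. Kottwitz, *Base change for unit elements of Hecke algebras*, Compositio Math. 60 (1986), §3 (counting fixed lattices shell by shell).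
* [BruhatTits1972] F. Bruhat, J. Tits, *Groupes réductifs sur un corps local I*, Publ. Math. IHÉS 41 (1972), §10 (lattice models of the building).
* [Serre1980Trees] J.-P. Serre, *Trees* (1980), II.1.1.
-/

set_option autoImplicit false

noncomputable section

open scoped Valued WithZero Matrix MatrixGroups
open Polynomial Classical SimpleGraph
open Literature.NumberTheory.Automorphic Literature.NumberTheory.Automorphic.HermitianLattice

namespace Literature.NumberTheory.Automorphic.UnitaryLatticeTree

variable {K : Type*} [Field K] [Valued K ℤᵐ⁰] {σ : K →+* K} {ϖ : K}

/-- **TWO REGION DIRECTIONS at an adapted NON-END region vertex.**  `v = u·r₀` self-dual with `LEV[v](ϖ^{d₀})`, adapted (`|⟨A e_{i₀}, u e₀⟩| < 1`), and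
`ϖ^{s'−1}A e_k ∈ v`: exactly `2` children `(uκ)·N₁` are region directions (★ `ncard_adj_regDir_eq_two` with `y₁ = u⁻¹(A e_{i₀})` — unit Gram, anisotropic —, `y₂ =
u⁻¹(ϖ^{s'}A e_k) ≡ 0`, and `z = e₀ ⊥ y₁`). [cite: Kottwitz1986, §3] [cite: BruhatTits1972, §10] [cite: Serre1980Trees, II.1.1] -/
theorem ncard_regDir_eq_two_of_adapted (hσ : ∀ x, σ (σ x) = x) (hvσ : ∀ a, Valued.v (σ a) = Valued.v a) (hσϖ : σ ϖ = -ϖ)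
    (hϖ : Valued.v ϖ = WithZero.exp (-1 : ℤ)) (hres : ∀ x : K, Valued.v x ≤ 1 → Valued.v (σ x - x) < 1) (h2 : Valued.v (2 : K) = 1) [Finite 𝓀[K]]
    {γ : unitaryGroupOfForm σ ((StdForm.antidiagonal 3).over K)} {d : Fin 3 → K} (hd : ∀ i, Valued.v (d i) = 1)
    (A : GL (Fin 3) K) (hdA : Matrix.diagonal d = (-(Matrix.diagonal d).det) • formCongr σ A ((StdForm.antidiagonal 3).over K))
    (s : Fin 3 → K) (hγA : ((γ : GL (Fin 3) K) : Matrix (Fin 3) (Fin 3) K) = (A : Matrix (Fin 3) (Fin 3) K) * Matrix.diagonal s * ((A⁻¹ : GL (Fin 3) K) : Matrix (Fin 3) (Fin 3) K))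
    (i₀ : Fin 3) {d₀ : ℕ} (he : ∀ i, Valued.v (s i - 1) ≤ Valued.v ϖ ^ d₀) (hiso : ∀ m, m ≠ i₀ → Valued.v (s i₀ - s m) = Valued.v ϖ ^ d₀)
    {s' : ℕ} (hs' : 1 ≤ s') (hgap : ∀ j k, j ≠ i₀ → k ≠ i₀ → j ≠ k → Valued.v (s j - s k) = Valued.v ϖ ^ (d₀ + 2 * s')) {k : Fin 3} (hk : k ≠ i₀)
    (u : unitaryGroupOfForm σ ((StdForm.antidiagonal 3).over K)) {v : {M : Submodule 𝒪[K] (Fin 3 → K) // IsVertex σ ϖ ((StdForm.antidiagonal 3).over K) M}} (hvu : v = latticeGraphIso σ ϖ ((StdForm.antidiagonal 3).over K) u ⟨stdLattice K 3, 0, isSelfDualLattice_stdLattice_three_of_v hϖ⟩)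
    (hv : IsSelfDualLattice σ ϖ ((StdForm.antidiagonal 3).over K) v.1) (hvR : v.1.map ((Matrix.toLin' (((γ : GL (Fin 3) K) : Matrix (Fin 3) (Fin 3) K) - 1)).restrictScalars 𝒪[K]) ≤ scaleLattice (ϖ ^ d₀) v.1)
    (hlam : Valued.v (pairing σ ((StdForm.antidiagonal 3).over K) ((A : Matrix (Fin 3) (Fin 3) K) *ᵥ Pi.single i₀ 1) (((u : GL (Fin 3) K) : Matrix (Fin 3) (Fin 3) K) *ᵥ Pi.single 0 1)) < 1) (hne : (ϖ ^ (s' - 1) • ((A : Matrix (Fin 3) (Fin 3) K) *ᵥ Pi.single k 1)) ∈ v.1) :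
    ({c : {M : Submodule 𝒪[K] (Fin 3 → K) // IsVertex σ ϖ ((StdForm.antidiagonal 3).over K) M} | (latticeGraph σ ϖ ((StdForm.antidiagonal 3).over K)).Adj v c ∧ ∃ κ : unitaryGroupOfForm σ ((StdForm.antidiagonal 3).over K), κ ∈ unitaryInt σ ((StdForm.antidiagonal 3).over K) ∧ c = latticeGraphIso σ ϖ ((StdForm.antidiagonal 3).over K) (u * κ) ⟨latt (Matrix.diagonal ![(1 : K), 1, ϖ]), 2, isVertexLattice_two_N₁_of_neg hσϖ hϖ⟩ ∧ (Valued.v (pairing σ ((StdForm.antidiagonal 3).over K) ((((u * κ : unitaryGroupOfForm σ ((StdForm.antidiagonal 3).over K)) : GL (Fin 3) K) : Matrix (Fin 3) (Fin 3) K) *ᵥ Pi.single 0 1) ((A : Matrix (Fin 3) (Fin 3) K) *ᵥ Pi.single i₀ 1)) < 1 ∧ Valued.v (pairing σ ((StdForm.antidiagonal 3).over K) ((((u * κ : unitaryGroupOfForm σ ((StdForm.antidiagonal 3).over K)) : GL (Fin 3) K) : Matrix (Fin 3) (Fin 3) K) *ᵥ Pi.single 0 1) (ϖ ^ s' • ((A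 : Matrix (Fin 3) (Fin 3) K) *ᵥ Pi.single k 1))) < 1)}).ncard = 2 := by
  have hϖ0 : ϖ ≠ 0 := fun h0 => by rw [h0, map_zero] at hϖ; exact WithZero.coe_ne_zero hϖ.symm
  have hvϖ0 : Valued.v ϖ ≠ 0 := (Valuation.ne_zero_iff _).2 hϖ0
  have hϖ1 : Valued.v ϖ < 1 := by rw [hϖ, ← WithZero.exp_zero]; exact WithZero.exp_lt_exp.2 (by norm_num)
  have hlt1 : ∀ z : K, Valued.v z < 1 ↔ Valued.v z ≤ Valued.v ϖ := fun z => by rw [hϖ]; exact v_lt_one_iff z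
  have hH : ∀ a b, σ (((StdForm.antidiagonal 3).over K) a b) = ((StdForm.antidiagonal 3).over K) b a := map_antidiagonal_three_over_apply_eq σ
  have hdet : -(Matrix.diagonal d).det ≠ 0 := by
    rw [neg_ne_zero, Matrix.det_diagonal]; exact Finset.prod_ne_zero_iff.2 fun i _ h0 => by have := hd i; rw [h0, map_zero] at this; exact zero_ne_one this
  have hκv : Valued.v (-(Matrix.diagonal d).det)⁻¹ = 1 := v_inv_neg_det_diagonal_eq_one hd
  -- Gram of the eigenframe
  have hgram : ∀ a b : Fin 3, pairing σ ((StdForm.antidiagonal 3).over K) ((A : Matrix (Fin 3) (Fin 3) K) *ᵥ Pi.single a 1) ((A : Matrix (Fin 3) (Fin 3) K) *ᵥ Pi.single b 1) = (-(Matrix.diagonal d).det)⁻¹ * Matrix.diagonal d a b := by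
    intro a b
    rw [pairing_mulVec_mulVec, pairing_single_single]
    have h := congrFun (congrFun hdA a) b
    rw [Matrix.smul_apply, smul_eq_mul] at h
    rw [h, ← mul_assoc, inv_mul_cancel₀ hdet, one_mul]
  -- the frame `u`
  have hv1 : v.1 = latt ((u : GL (Fin 3) K) : Matrix (Fin 3) (Fin 3) K) := by rw [hvu, latticeGraphIso_apply_val]; rfl
  have hUI : (((u⁻¹ : unitaryGroupOfForm σ ((StdForm.antidiagonal 3).over K)) : GL (Fin 3) K) : Matrix (Fin 3) (Fin 3) K) = (((u : GL (Fin 3) K) : Matrix (Fin 3) (Fin 3) K))⁻¹ := by rw [Subgroup.coe_inv, Matrix.coe_units_inv]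
  have hUdet : IsUnit (((u : GL (Fin 3) K) : Matrix (Fin 3) (Fin 3) K)).det := Matrix.isUnits_det_units _
  have hUIU : ∀ x : Fin 3 → K, (((u⁻¹ : unitaryGroupOfForm σ ((StdForm.antidiagonal 3).over K)) : GL (Fin 3) K) : Matrix (Fin 3) (Fin 3) K) *ᵥ (((u : GL (Fin 3) K) : Matrix (Fin 3) (Fin 3) K) *ᵥ x) = x := fun x => by
    rw [Matrix.mulVec_mulVec, hUI, Matrix.nonsing_inv_mul _ hUdet, Matrix.one_mulVec]
  have hUUI : ∀ x : Fin 3 → K, ((u : GL (Fin 3) K) : Matrix (Fin 3) (Fin 3) K) *ᵥ ((((u⁻¹ : unitaryGroupOfForm σ ((StdForm.antidiagonal 3).over K)) : GL (Fin 3) K) : Matrix (Fin 3) (Fin 3) K) *ᵥ x) = x := fun x => by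
    rw [Matrix.mulVec_mulVec, hUI, Matrix.mul_nonsing_inv _ hUdet, Matrix.one_mulVec]
  have hinvU : ∀ y z : Fin 3 → K, pairing σ ((StdForm.antidiagonal 3).over K) ((((u⁻¹ : unitaryGroupOfForm σ ((StdForm.antidiagonal 3).over K)) : GL (Fin 3) K) : Matrix (Fin 3) (Fin 3) K) *ᵥ y) ((((u⁻¹ : unitaryGroupOfForm σ ((StdForm.antidiagonal 3).over K)) : GL (Fin 3) K) : Matrix (Fin 3) (Fin 3) K) *ᵥ z) = pairing σ ((StdForm.antidiagonal 3).over K) y z :=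
    fun y z => pairing_mulVec_mulVec_of_mem_unitary (u⁻¹).2 y z
  -- the two integral test vectors (★ REGION CRITERION)
  obtain ⟨hui₀, huk⟩ := (map_sub_one_le_scaleLattice_iff_mem_and_mem_of_isSelfDualLattice hσ hvσ hϖ A hd hdA s hγA i₀ he hiso hgap hv hk).1 hvR
  have hwint : ∀ i, Valued.v (((((u⁻¹ : unitaryGroupOfForm σ ((StdForm.antidiagonal 3).over K)) : GL (Fin 3) K) : Matrix (Fin 3) (Fin 3) K) *ᵥ ((A : Matrix (Fin 3) (Fin 3) K) *ᵥ Pi.single i₀ 1)) i) ≤ 1 := by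
    have h := (mem_latt_iff_of_isUnit hUdet _).1 (hv1 ▸ hui₀)
    rw [← hUI] at h
    exact h
  have hmint : ∀ i, Valued.v (((((u⁻¹ : unitaryGroupOfForm σ ((StdForm.antidiagonal 3).over K)) : GL (Fin 3) K) : Matrix (Fin 3) (Fin 3) K) *ᵥ (ϖ ^ s' • ((A : Matrix (Fin 3) (Fin 3) K) *ᵥ Pi.single k 1))) i) ≤ 1 := by
    have h := (mem_latt_iff_of_isUnit hUdet _).1 (hv1 ▸ huk)
    rw [← hUI] at h
    exact h
  set y₁ : Fin 3 → 𝒪[K] := fun i => ⟨((((u⁻¹ : unitaryGroupOfForm σ ((StdForm.antidiagonal 3).over K)) : GL (Fin 3) K) : Matrix (Fin 3) (Fin 3) K) *ᵥ ((A : Matrix (Fin 3) (Fin 3) K) *ᵥ Pi.single i₀ 1)) i, hwint i⟩ with hy₁def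
  set y₂ : Fin 3 → 𝒪[K] := fun i => ⟨((((u⁻¹ : unitaryGroupOfForm σ ((StdForm.antidiagonal 3).over K)) : GL (Fin 3) K) : Matrix (Fin 3) (Fin 3) K) *ᵥ (ϖ ^ s' • ((A : Matrix (Fin 3) (Fin 3) K) *ᵥ Pi.single k 1))) i, hmint i⟩ with hy₂def
  have hy₁c : (fun i => (y₁ i : K)) = (((u⁻¹ : unitaryGroupOfForm σ ((StdForm.antidiagonal 3).over K)) : GL (Fin 3) K) : Matrix (Fin 3) (Fin 3) K) *ᵥ ((A : Matrix (Fin 3) (Fin 3) K) *ᵥ Pi.single i₀ 1) := rfl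
  have hy₂c : (fun i => (y₂ i : K)) = (((u⁻¹ : unitaryGroupOfForm σ ((StdForm.antidiagonal 3).over K)) : GL (Fin 3) K) : Matrix (Fin 3) (Fin 3) K) *ᵥ (ϖ ^ s' • ((A : Matrix (Fin 3) (Fin 3) K) *ᵥ Pi.single k 1)) := rfl
  have hy₁ : ((u : GL (Fin 3) K) : Matrix (Fin 3) (Fin 3) K) *ᵥ (fun i => (y₁ i : K)) = ((A : Matrix (Fin 3) (Fin 3) K) *ᵥ Pi.single i₀ 1) := by rw [hy₁c, hUUI]
  have hy₂ : ((u : GL (Fin 3) K) : Matrix (Fin 3) (Fin 3) K) *ᵥ (fun i => (y₂ i : K)) = (ϖ ^ s' • ((A : Matrix (Fin 3) (Fin 3) K) *ᵥ Pi.single k 1)) := by rw [hy₂c, hUUI]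
  -- END test: `ϖ^(s'−1)·A e_k ∈ v` iff all coordinates of `y₂` are non-units
  have hms : (((u⁻¹ : unitaryGroupOfForm σ ((StdForm.antidiagonal 3).over K)) : GL (Fin 3) K) : Matrix (Fin 3) (Fin 3) K) *ᵥ (ϖ ^ s' • ((A : Matrix (Fin 3) (Fin 3) K) *ᵥ Pi.single k 1)) = ϖ • ((((u⁻¹ : unitaryGroupOfForm σ ((StdForm.antidiagonal 3).over K)) : GL (Fin 3) K) : Matrix (Fin 3) (Fin 3) K) *ᵥ (ϖ ^ (s' - 1) • ((A : Matrix (Fin 3) (Fin 3) K) *ᵥ Pi.single k 1))) := by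
    rw [Matrix.mulVec_smul, Matrix.mulVec_smul, smul_smul, ← pow_succ', Nat.sub_add_cancel hs']
  have hcoord : ∀ i, ((((u⁻¹ : unitaryGroupOfForm σ ((StdForm.antidiagonal 3).over K)) : GL (Fin 3) K) : Matrix (Fin 3) (Fin 3) K) *ᵥ (ϖ ^ (s' - 1) • ((A : Matrix (Fin 3) (Fin 3) K) *ᵥ Pi.single k 1))) i = ϖ⁻¹ * ((((u⁻¹ : unitaryGroupOfForm σ ((StdForm.antidiagonal 3).over K)) : GL (Fin 3) K) : Matrix (Fin 3) (Fin 3) K) *ᵥ (ϖ ^ s' • ((A : Matrix (Fin 3) (Fin 3) K) *ᵥ Pi.single k 1))) i := fun i => by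
    rw [hms, Pi.smul_apply, smul_eq_mul, inv_mul_cancel_left₀ hϖ0]
  have hmem : (ϖ ^ (s' - 1) • ((A : Matrix (Fin 3) (Fin 3) K) *ᵥ Pi.single k 1)) ∈ v.1 ↔ ∀ i, Valued.v (((((u⁻¹ : unitaryGroupOfForm σ ((StdForm.antidiagonal 3).over K)) : GL (Fin 3) K) : Matrix (Fin 3) (Fin 3) K) *ᵥ (ϖ ^ s' • ((A : Matrix (Fin 3) (Fin 3) K) *ᵥ Pi.single k 1))) i) < 1 := by
    rw [hv1, mem_latt_iff_of_isUnit hUdet, ← hUI, mem_stdLattice]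
    refine forall_congr' fun i => ?_
    rw [hcoord, hlt1, map_mul, map_inv₀, inv_mul_le_iff₀ (zero_lt_iff.2 hvϖ0), mul_one]

  -- `y₁` anisotropic
  have hy₁a : ¬ Valued.v (B₀ σ 3 (fun i => (y₁ i : K)) (fun i => (y₁ i : K))) < 1 := by
    rw [hy₁c, ← pairing_antidiagonal, hinvU, hgram, Matrix.diagonal_apply_eq, map_mul, hκv, hd, one_mul]
    exact lt_irrefl 1
  -- `y₂ ≡ 0`
  have hy₂0 : (fun i => IsLocalRing.residue 𝒪[K] (y₂ i)) = 0 := by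
    funext i
    rw [Pi.zero_apply, residue_eq_zero_iff_v_lt_one]
    exact hmem.1 hne i
  -- `z = e₀`: primitive, isotropic, `⊥ y₁` (adaptation)
  have hzint : ∀ i, Valued.v ((Pi.single 0 1 : Fin 3 → K) i) ≤ 1 := fun i => mem_stdLattice.1 (single_mem_stdLattice 0) i
  have hzy : Valued.v (B₀ σ 3 (fun i => (((fun i => (⟨(Pi.single 0 1 : Fin 3 → K) i, hzint i⟩ : 𝒪[K])) i) : K)) (fun i => (y₁ i : K))) < 1 := by
    show Valued.v (B₀ σ 3 (Pi.single 0 1) (fun i => (y₁ i : K))) < 1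
    rw [hy₁c, ← pairing_antidiagonal, v_pairing_comm_of_hermitian hvσ hσ hH, ← hUIU (Pi.single 0 1), hinvU]
    exact hlam
  refine ncard_adj_regDir_eq_two hσ hvσ hσϖ hϖ hres h2 A i₀ s' k u hvu y₁ y₂ hy₁ hy₂ hy₁a hy₂0 (fun i => ⟨(Pi.single 0 1 : Fin 3 → K) i, hzint i⟩) ⟨0, by simp⟩ ?_ hzy
  show Valued.v (B₀ σ 3 (Pi.single 0 1) (Pi.single 0 1 : Fin 3 → K)) < 1
  rw [B₀_single_left]; simp

/-- **ONE REGION DIRECTION at an END region vertex** (`v = u·r₀`, any frame `u` — no adaptation needed).  As above but `ϖ^{s'−1}A e_k ∉ v`: then `y₂ = u⁻¹(ϖ^{s'}A e_k)` is primitive, isotropic (`|⟨y₂,y₂⟩| =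
|ϖ|^{2s'}`) and `⊥ y₁` (diagonal Gram), so exactly `1` child is a region direction (★ `ncard_adj_regDir_eq_one`). [cite: Kottwitz1986, §3] [cite: BruhatTits1972, §10]
[cite: Serre1980Trees, II.1.1] -/
theorem ncard_regDir_eq_one_of_adapted (hσ : ∀ x, σ (σ x) = x) (hvσ : ∀ a, Valued.v (σ a) = Valued.v a) (hσϖ : σ ϖ = -ϖ)
    (hϖ : Valued.v ϖ = WithZero.exp (-1 : ℤ)) (hres : ∀ x : K, Valued.v x ≤ 1 → Valued.v (σ x - x) < 1) (h2 : Valued.v (2 : K) = 1) [Finite 𝓀[K]]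
    {γ : unitaryGroupOfForm σ ((StdForm.antidiagonal 3).over K)} {d : Fin 3 → K} (hd : ∀ i, Valued.v (d i) = 1)
    (A : GL (Fin 3) K) (hdA : Matrix.diagonal d = (-(Matrix.diagonal d).det) • formCongr σ A ((StdForm.antidiagonal 3).over K))
    (s : Fin 3 → K) (hγA : ((γ : GL (Fin 3) K) : Matrix (Fin 3) (Fin 3) K) = (A : Matrix (Fin 3) (Fin 3) K) * Matrix.diagonal s * ((A⁻¹ : GL (Fin 3) K) : Matrix (Fin 3) (Fin 3) K))
    (i₀ : Fin 3) {d₀ : ℕ} (he : ∀ i, Valued.v (s i - 1) ≤ Valued.v ϖ ^ d₀) (hiso : ∀ m, m ≠ i₀ → Valued.v (s i₀ - s m) = Valued.v ϖ ^ d₀)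
    {s' : ℕ} (hs' : 1 ≤ s') (hgap : ∀ j k, j ≠ i₀ → k ≠ i₀ → j ≠ k → Valued.v (s j - s k) = Valued.v ϖ ^ (d₀ + 2 * s')) {k : Fin 3} (hk : k ≠ i₀)
    (u : unitaryGroupOfForm σ ((StdForm.antidiagonal 3).over K)) {v : {M : Submodule 𝒪[K] (Fin 3 → K) // IsVertex σ ϖ ((StdForm.antidiagonal 3).over K) M}} (hvu : v = latticeGraphIso σ ϖ ((StdForm.antidiagonal 3).over K) u ⟨stdLattice K 3, 0, isSelfDualLattice_stdLattice_three_of_v hϖ⟩)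
    (hv : IsSelfDualLattice σ ϖ ((StdForm.antidiagonal 3).over K) v.1) (hvR : v.1.map ((Matrix.toLin' (((γ : GL (Fin 3) K) : Matrix (Fin 3) (Fin 3) K) - 1)).restrictScalars 𝒪[K]) ≤ scaleLattice (ϖ ^ d₀) v.1)
    (hend : ¬ (ϖ ^ (s' - 1) • ((A : Matrix (Fin 3) (Fin 3) K) *ᵥ Pi.single k 1)) ∈ v.1) :
    ({c : {M : Submodule 𝒪[K] (Fin 3 → K) // IsVertex σ ϖ ((StdForm.antidiagonal 3).over K) M} | (latticeGraph σ ϖ ((StdForm.antidiagonal 3).over K)).Adj v c ∧ ∃ κ : unitaryGroupOfForm σ ((StdForm.antidiagonal 3).over K), κ ∈ unitaryInt σ ((StdForm.antidiagonal 3).over K) ∧ c = latticeGraphIso σ ϖ ((StdForm.antidiagonal 3).over K) (u * κ) ⟨latt (Matrix.diagonal ![(1 : K), 1, ϖ]), 2, isVertexLattice_two_N₁_of_neg hσϖ hϖ⟩ ∧ (Valued.v (pairing σ ((StdForm.antidiagonal 3).over K) ((((u * κ : unitaryGroupOfForm σ ((StdForm.antidiagonal 3).over K)) : GL (Fin 3)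 K) : Matrix (Fin 3) (Fin 3) K) *ᵥ Pi.single 0 1) ((A : Matrix (Fin 3) (Fin 3) K) *ᵥ Pi.single i₀ 1)) < 1 ∧ Valued.v (pairing σ ((StdForm.antidiagonal 3).over K) ((((u * κ : unitaryGroupOfForm σ ((StdForm.antidiagonal 3).over K)) : GL (Fin 3) K) : Matrix (Fin 3) (Fin 3) K) *ᵥ Pi.single 0 1) (ϖ ^ s' • ((A : Matrix (Fin 3) (Fin 3) K) *ᵥ Pi.single k 1))) < 1)}).ncard = 1 := by
  have hϖ0 : ϖ ≠ 0 := fun h0 => by rw [h0, map_zero] at hϖ; exact WithZero.coe_ne_zero hϖ.symm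
  have hvϖ0 : Valued.v ϖ ≠ 0 := (Valuation.ne_zero_iff _).2 hϖ0
  have hϖ1 : Valued.v ϖ < 1 := by rw [hϖ, ← WithZero.exp_zero]; exact WithZero.exp_lt_exp.2 (by norm_num)
  have hlt1 : ∀ z : K, Valued.v z < 1 ↔ Valued.v z ≤ Valued.v ϖ := fun z => by rw [hϖ]; exact v_lt_one_iff z
  have hH : ∀ a b, σ (((StdForm.antidiagonal 3).over K) a b) = ((StdForm.antidiagonal 3).over K) b a := map_antidiagonal_three_over_apply_eq σ
  have hdet : -(Matrix.diagonal d).det ≠ 0 := by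
    rw [neg_ne_zero, Matrix.det_diagonal]; exact Finset.prod_ne_zero_iff.2 fun i _ h0 => by have := hd i; rw [h0, map_zero] at this; exact zero_ne_one this
  have hκv : Valued.v (-(Matrix.diagonal d).det)⁻¹ = 1 := v_inv_neg_det_diagonal_eq_one hd
  -- Gram of the eigenframe
  have hgram : ∀ a b : Fin 3, pairing σ ((StdForm.antidiagonal 3).over K) ((A : Matrix (Fin 3) (Fin 3) K) *ᵥ Pi.single a 1) ((A : Matrix (Fin 3) (Fin 3) K) *ᵥ Pi.single b 1) = (-(Matrix.diagonal d).det)⁻¹ * Matrix.diagonal d a b := by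
    intro a b
    rw [pairing_mulVec_mulVec, pairing_single_single]
    have h := congrFun (congrFun hdA a) b
    rw [Matrix.smul_apply, smul_eq_mul] at h
    rw [h, ← mul_assoc, inv_mul_cancel₀ hdet, one_mul]
  -- the frame `u`
  have hv1 : v.1 = latt ((u : GL (Fin 3) K) : Matrix (Fin 3) (Fin 3) K) := by rw [hvu, latticeGraphIso_apply_val]; rfl
  have hUI : (((u⁻¹ : unitaryGroupOfForm σ ((StdForm.antidiagonal 3).over K)) : GL (Fin 3) K) : Matrix (Fin 3) (Fin 3) K) = (((u : GL (Fin 3) K) : Matrix (Fin 3) (Fin 3) K))⁻¹ := by rw [Subgroup.coe_inv, Matrix.coe_units_inv]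
  have hUdet : IsUnit (((u : GL (Fin 3) K) : Matrix (Fin 3) (Fin 3) K)).det := Matrix.isUnits_det_units _
  have hUIU : ∀ x : Fin 3 → K, (((u⁻¹ : unitaryGroupOfForm σ ((StdForm.antidiagonal 3).over K)) : GL (Fin 3) K) : Matrix (Fin 3) (Fin 3) K) *ᵥ (((u : GL (Fin 3) K) : Matrix (Fin 3) (Fin 3) K) *ᵥ x) = x := fun x => by
    rw [Matrix.mulVec_mulVec, hUI, Matrix.nonsing_inv_mul _ hUdet, Matrix.one_mulVec]
  have hUUI : ∀ x : Fin 3 → K, ((u : GL (Fin 3) K) : Matrix (Fin 3) (Fin 3) K) *ᵥ ((((u⁻¹ : unitaryGroupOfForm σ ((StdForm.antidiagonal 3).over K)) : GL (Fin 3) K) : Matrix (Fin 3) (Fin 3) K) *ᵥ x) = x := fun x => by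
    rw [Matrix.mulVec_mulVec, hUI, Matrix.mul_nonsing_inv _ hUdet, Matrix.one_mulVec]
  have hinvU : ∀ y z : Fin 3 → K, pairing σ ((StdForm.antidiagonal 3).over K) ((((u⁻¹ : unitaryGroupOfForm σ ((StdForm.antidiagonal 3).over K)) : GL (Fin 3) K) : Matrix (Fin 3) (Fin 3) K) *ᵥ y) ((((u⁻¹ : unitaryGroupOfForm σ ((StdForm.antidiagonal 3).over K)) : GL (Fin 3) K) : Matrix (Fin 3) (Fin 3) K) *ᵥ z) = pairing σ ((StdForm.antidiagonal 3).over K) y z :=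
    fun y z => pairing_mulVec_mulVec_of_mem_unitary (u⁻¹).2 y z
  -- the two integral test vectors (★ REGION CRITERION)
  obtain ⟨hui₀, huk⟩ := (map_sub_one_le_scaleLattice_iff_mem_and_mem_of_isSelfDualLattice hσ hvσ hϖ A hd hdA s hγA i₀ he hiso hgap hv hk).1 hvR
  have hwint : ∀ i, Valued.v (((((u⁻¹ : unitaryGroupOfForm σ ((StdForm.antidiagonal 3).over K)) : GL (Fin 3) K) : Matrix (Fin 3) (Fin 3) K) *ᵥ ((A : Matrix (Fin 3) (Fin 3) K) *ᵥ Pi.single i₀ 1)) i) ≤ 1 := by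
    have h := (mem_latt_iff_of_isUnit hUdet _).1 (hv1 ▸ hui₀)
    rw [← hUI] at h
    exact h
  have hmint : ∀ i, Valued.v (((((u⁻¹ : unitaryGroupOfForm σ ((StdForm.antidiagonal 3).over K)) : GL (Fin 3) K) : Matrix (Fin 3) (Fin 3) K) *ᵥ (ϖ ^ s' • ((A : Matrix (Fin 3) (Fin 3) K) *ᵥ Pi.single k 1))) i) ≤ 1 := by
    have h := (mem_latt_iff_of_isUnit hUdet _).1 (hv1 ▸ huk)
    rw [← hUI] at h
    exact h
  set y₁ : Fin 3 → 𝒪[K] := fun i => ⟨((((u⁻¹ : unitaryGroupOfForm σ ((StdForm.antidiagonal 3).over K)) : GL (Fin 3) K) : Matrix (Fin 3) (Fin 3) K) *ᵥ ((A : Matrix (Fin 3) (Fin 3) K) *ᵥ Pi.single i₀ 1)) i, hwint i⟩ with hy₁def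
  set y₂ : Fin 3 → 𝒪[K] := fun i => ⟨((((u⁻¹ : unitaryGroupOfForm σ ((StdForm.antidiagonal 3).over K)) : GL (Fin 3) K) : Matrix (Fin 3) (Fin 3) K) *ᵥ (ϖ ^ s' • ((A : Matrix (Fin 3) (Fin 3) K) *ᵥ Pi.single k 1))) i, hmint i⟩ with hy₂def
  have hy₁c : (fun i => (y₁ i : K)) = (((u⁻¹ : unitaryGroupOfForm σ ((StdForm.antidiagonal 3).over K)) : GL (Fin 3) K) : Matrix (Fin 3) (Fin 3) K) *ᵥ ((A : Matrix (Fin 3) (Fin 3) K) *ᵥ Pi.single i₀ 1) := rfl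
  have hy₂c : (fun i => (y₂ i : K)) = (((u⁻¹ : unitaryGroupOfForm σ ((StdForm.antidiagonal 3).over K)) : GL (Fin 3) K) : Matrix (Fin 3) (Fin 3) K) *ᵥ (ϖ ^ s' • ((A : Matrix (Fin 3) (Fin 3) K) *ᵥ Pi.single k 1)) := rfl
  have hy₁ : ((u : GL (Fin 3) K) : Matrix (Fin 3) (Fin 3) K) *ᵥ (fun i => (y₁ i : K)) = ((A : Matrix (Fin 3) (Fin 3) K) *ᵥ Pi.single i₀ 1) := by rw [hy₁c, hUUI]
  have hy₂ : ((u : GL (Fin 3) K) : Matrix (Fin 3) (Fin 3) K) *ᵥ (fun i => (y₂ i : K)) = (ϖ ^ s' • ((A : Matrix (Fin 3) (Fin 3) K) *ᵥ Pi.single k 1)) := by rw [hy₂c, hUUI]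
  -- END test: `ϖ^(s'−1)·A e_k ∈ v` iff all coordinates of `y₂` are non-units
  have hms : (((u⁻¹ : unitaryGroupOfForm σ ((StdForm.antidiagonal 3).over K)) : GL (Fin 3) K) : Matrix (Fin 3) (Fin 3) K) *ᵥ (ϖ ^ s' • ((A : Matrix (Fin 3) (Fin 3) K) *ᵥ Pi.single k 1)) = ϖ • ((((u⁻¹ : unitaryGroupOfForm σ ((StdForm.antidiagonal 3).over K)) : GL (Fin 3) K) : Matrix (Fin 3) (Fin 3) K) *ᵥ (ϖ ^ (s' - 1) • ((A : Matrix (Fin 3) (Fin 3) K) *ᵥ Pi.single k 1))) := by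
    rw [Matrix.mulVec_smul, Matrix.mulVec_smul, smul_smul, ← pow_succ', Nat.sub_add_cancel hs']
  have hcoord : ∀ i, ((((u⁻¹ : unitaryGroupOfForm σ ((StdForm.antidiagonal 3).over K)) : GL (Fin 3) K) : Matrix (Fin 3) (Fin 3) K) *ᵥ (ϖ ^ (s' - 1) • ((A : Matrix (Fin 3) (Fin 3) K) *ᵥ Pi.single k 1))) i = ϖ⁻¹ * ((((u⁻¹ : unitaryGroupOfForm σ ((StdForm.antidiagonal 3).over K)) : GL (Fin 3) K) : Matrix (Fin 3) (Fin 3) K) *ᵥ (ϖ ^ s' • ((A : Matrix (Fin 3) (Fin 3) K) *ᵥ Pi.single k 1))) i := fun i => by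
    rw [hms, Pi.smul_apply, smul_eq_mul, inv_mul_cancel_left₀ hϖ0]
  have hmem : (ϖ ^ (s' - 1) • ((A : Matrix (Fin 3) (Fin 3) K) *ᵥ Pi.single k 1)) ∈ v.1 ↔ ∀ i, Valued.v (((((u⁻¹ : unitaryGroupOfForm σ ((StdForm.antidiagonal 3).over K)) : GL (Fin 3) K) : Matrix (Fin 3) (Fin 3) K) *ᵥ (ϖ ^ s' • ((A : Matrix (Fin 3) (Fin 3) K) *ᵥ Pi.single k 1))) i) < 1 := by
    rw [hv1, mem_latt_iff_of_isUnit hUdet, ← hUI, mem_stdLattice]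
    refine forall_congr' fun i => ?_
    rw [hcoord, hlt1, map_mul, map_inv₀, inv_mul_le_iff₀ (zero_lt_iff.2 hvϖ0), mul_one]

  -- `y₂` primitive
  have hy₂u : ∃ j, Valued.v ((y₂ j : 𝒪[K]) : K) = 1 := by
    by_contra hne
    push Not at hne
    exact hend (hmem.2 fun i => lt_of_le_of_ne (hmint i) (hne i))
  -- `y₂` isotropic to first order, `⊥ y₁`
  have hmm : pairing σ ((StdForm.antidiagonal 3).over K) (ϖ ^ s' • ((A : Matrix (Fin 3) (Fin 3) K) *ᵥ Pi.single k 1)) (ϖ ^ s' • ((A : Matrix (Fin 3) (Fin 3) K) *ᵥ Pi.single k 1)) = σ (ϖ ^ s') * (ϖ ^ s' * ((-(Matrix.diagonal d).det)⁻¹ * Matrix.diagonal d k k)) := by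
    rw [LinearMap.map_smulₛₗ₂, map_smul, smul_eq_mul, smul_eq_mul, hgram]
  have hy₂iso : Valued.v (B₀ σ 3 (fun i => (y₂ i : K)) (fun i => (y₂ i : K))) < 1 := by
    rw [hy₂c, ← pairing_antidiagonal, hinvU, hmm, Matrix.diagonal_apply_eq, map_mul, map_mul, map_mul, hvσ, hκv, hd, mul_one, mul_one, map_pow]
    calc Valued.v ϖ ^ s' * Valued.v ϖ ^ s' < 1 * 1 :=
          mul_lt_mul'' (pow_lt_one₀ zero_le hϖ1 (by omega)) (pow_lt_one₀ zero_le hϖ1 (by omega)) zero_le zero_le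
      _ = 1 := one_mul 1
  have hmk : pairing σ ((StdForm.antidiagonal 3).over K) (ϖ ^ s' • ((A : Matrix (Fin 3) (Fin 3) K) *ᵥ Pi.single k 1)) ((A : Matrix (Fin 3) (Fin 3) K) *ᵥ Pi.single i₀ 1) = σ (ϖ ^ s') * ((-(Matrix.diagonal d).det)⁻¹ * Matrix.diagonal d k i₀) := by
    rw [LinearMap.map_smulₛₗ₂, smul_eq_mul, hgram]
  have hy₂₁ : Valued.v (B₀ σ 3 (fun i => (y₂ i : K)) (fun i => (y₁ i : K))) < 1 := by
    rw [hy₂c, hy₁c, ← pairing_antidiagonal, hinvU, hmk, Matrix.diagonal_apply_ne _ hk, mul_zero, mul_zero, map_zero]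
    exact zero_lt_one
  exact ncard_adj_regDir_eq_one hσ hvσ hσϖ hϖ hres h2 A i₀ s' k u hvu y₁ y₂ hy₁ hy₂ hy₂u hy₂iso hy₂₁

/-! ## ED. 2 — the ROOT of a hyperbolic isoceles literal has a region-direction child (so it admits an adapted frame, ★ `exists_adaptedFrame_root_of_regDir`) -/

/-- **A HYPERBOLIC ROOT PLANE HAS A REGION-DIRECTION CHILD.**  If `−d_j∕d_k` is a norm residue (`hhyp`: `|d_j + tσ(t)d_k| < 1` for a unit `t`), then some child `κ₁·N₁`
of the root (`κ₁ ∈ K₀`) is a region direction: `|⟨κ₁e₀, A e_{i₀}⟩| < 1 ∧ |⟨κ₁e₀, ϖ^{s'}A e_k⟩| < 1` (★ `ncard_adj_regDir_eq_two` at `u = 1` with the isotropic witness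
`z = A(e_j + t e_k) ⊥ A e_{i₀}`: the count is `2 ≠ 0`). [cite: Kottwitz1986, §3] [cite: BruhatTits1972, §10] [cite: Serre1980Trees, II.1.1] -/
theorem exists_regDir_root_child_of_hyperbolic (hσ : ∀ x, σ (σ x) = x) (hvσ : ∀ a, Valued.v (σ a) = Valued.v a) (hσϖ : σ ϖ = -ϖ)
    (hϖ : Valued.v ϖ = WithZero.exp (-1 : ℤ)) (hres : ∀ x : K, Valued.v x ≤ 1 → Valued.v (σ x - x) < 1) (h2 : Valued.v (2 : K) = 1) [Finite 𝓀[K]]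
    {d : Fin 3 → K} (hd : ∀ i, Valued.v (d i) = 1)
    (A : GL (Fin 3) K) (hA : IsIntMatrix (A : Matrix (Fin 3) (Fin 3) K)) (hA' : IsIntMatrix ((A⁻¹ : GL (Fin 3) K) : Matrix (Fin 3) (Fin 3) K))
    (hdA : Matrix.diagonal d = (-(Matrix.diagonal d).det) • formCongr σ A ((StdForm.antidiagonal 3).over K))
    (i₀ : Fin 3) {s' : ℕ} (hs' : 1 ≤ s') {j k : Fin 3} (hj : j ≠ i₀) (hk : k ≠ i₀) (hjk : j ≠ k)
    (hhyp : ∃ t : K, Valued.v t = 1 ∧ Valued.v (d j + t * σ t * d k) < 1) :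
    ∃ κ₁ : unitaryGroupOfForm σ ((StdForm.antidiagonal 3).over K), κ₁ ∈ unitaryInt σ ((StdForm.antidiagonal 3).over K) ∧
      (Valued.v (pairing σ ((StdForm.antidiagonal 3).over K) ((((1 * κ₁ : unitaryGroupOfForm σ ((StdForm.antidiagonal 3).over K)) : GL (Fin 3) K) : Matrix (Fin 3) (Fin 3) K) *ᵥ Pi.single 0 1) ((A : Matrix (Fin 3) (Fin 3) K) *ᵥ Pi.single i₀ 1)) < 1 ∧ Valued.v (pairing σ ((StdForm.antidiagonal 3).over K) ((((1 * κ₁ : unitaryGroupOfForm σ ((StdForm.antidiagonal 3).over K)) : GL (Fin 3) K) : Matrix (Fin 3) (Fin 3) K) *ᵥ Pi.single 0 1) (ϖ ^ s' • ((A : Matrix (Fin 3) (Fin 3) K) *ᵥ Pi.single k 1))) < 1) := by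
  have hϖ0 : ϖ ≠ 0 := fun h0 => by rw [h0, map_zero] at hϖ; exact WithZero.coe_ne_zero hϖ.symm
  have hvϖ0 : Valued.v ϖ ≠ 0 := (Valuation.ne_zero_iff _).2 hϖ0
  have hϖ1 : Valued.v ϖ < 1 := by rw [hϖ, ← WithZero.exp_zero]; exact WithZero.exp_lt_exp.2 (by norm_num)
  have hdet : -(Matrix.diagonal d).det ≠ 0 := by
    rw [neg_ne_zero, Matrix.det_diagonal]; exact Finset.prod_ne_zero_iff.2 fun i _ h0 => by have := hd i; rw [h0, map_zero] at this; exact zero_ne_one this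
  have hκv : Valued.v (-(Matrix.diagonal d).det)⁻¹ = 1 := v_inv_neg_det_diagonal_eq_one hd
  have hgram : ∀ a b : Fin 3, pairing σ ((StdForm.antidiagonal 3).over K) ((A : Matrix (Fin 3) (Fin 3) K) *ᵥ Pi.single a 1) ((A : Matrix (Fin 3) (Fin 3) K) *ᵥ Pi.single b 1) = (-(Matrix.diagonal d).det)⁻¹ * Matrix.diagonal d a b := by
    intro a b
    rw [pairing_mulVec_mulVec, pairing_single_single]
    have h := congrFun (congrFun hdA a) b
    rw [Matrix.smul_apply, smul_eq_mul] at h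
    rw [h, ← mul_assoc, inv_mul_cancel₀ hdet, one_mul]
  have hAcol : ∀ (m i : Fin 3), Valued.v (((A : Matrix (Fin 3) (Fin 3) K) *ᵥ Pi.single m 1) i) ≤ 1 := fun m i => by
    rw [Matrix.mulVec_single_one]; exact hA i m
  obtain ⟨t, ht1, htlt⟩ := hhyp
  -- the three integral vectors `y₁ = A e_{i₀}`, `y₂ = ϖ^{s'}A e_k`, `z = A e_j + t·A e_k`
  have hy₂int : ∀ i, Valued.v ((ϖ ^ s' • ((A : Matrix (Fin 3) (Fin 3) K) *ᵥ Pi.single k 1)) i) ≤ 1 := fun i => by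
    rw [Pi.smul_apply, smul_eq_mul, map_mul, map_pow]
    calc Valued.v ϖ ^ s' * Valued.v (((A : Matrix (Fin 3) (Fin 3) K) *ᵥ Pi.single k 1) i) ≤ 1 * 1 := mul_le_mul' (pow_le_one₀ zero_le hϖ1.le) (hAcol k i)
      _ = 1 := one_mul 1
  have hzint : ∀ i, Valued.v (((A : Matrix (Fin 3) (Fin 3) K) *ᵥ Pi.single j 1 + t • ((A : Matrix (Fin 3) (Fin 3) K) *ᵥ Pi.single k 1)) i) ≤ 1 := fun i => by
    rw [Pi.add_apply, Pi.smul_apply, smul_eq_mul]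
    refine le_trans (Valuation.map_add _ _ _) (max_le (hAcol j i) ?_)
    rw [map_mul, ht1, one_mul]; exact hAcol k i
  set y₁ : Fin 3 → 𝒪[K] := fun i => ⟨((A : Matrix (Fin 3) (Fin 3) K) *ᵥ Pi.single i₀ 1) i, hAcol i₀ i⟩ with hy₁def
  set y₂ : Fin 3 → 𝒪[K] := fun i => ⟨(ϖ ^ s' • ((A : Matrix (Fin 3) (Fin 3) K) *ᵥ Pi.single k 1)) i, hy₂int i⟩ with hy₂def
  set z : Fin 3 → 𝒪[K] := fun i => ⟨((A : Matrix (Fin 3) (Fin 3) K) *ᵥ Pi.single j 1 + t • ((A : Matrix (Fin 3) (Fin 3) K) *ᵥ Pi.single k 1)) i, hzint i⟩ with hzdef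
  have hy₁c : (fun i => (y₁ i : K)) = (A : Matrix (Fin 3) (Fin 3) K) *ᵥ Pi.single i₀ 1 := rfl
  have hy₂c : (fun i => (y₂ i : K)) = (ϖ ^ s' • ((A : Matrix (Fin 3) (Fin 3) K) *ᵥ Pi.single k 1)) := rfl
  have hzc : (fun i => (z i : K)) = (A : Matrix (Fin 3) (Fin 3) K) *ᵥ Pi.single j 1 + t • ((A : Matrix (Fin 3) (Fin 3) K) *ᵥ Pi.single k 1) := rfl
  have h1M : ((((1 : unitaryGroupOfForm σ ((StdForm.antidiagonal 3).over K)) : GL (Fin 3) K) : Matrix (Fin 3) (Fin 3) K)) = 1 := by rw [OneMemClass.coe_one, Units.val_one]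
  have hy₁ : (((1 : unitaryGroupOfForm σ ((StdForm.antidiagonal 3).over K)) : GL (Fin 3) K) : Matrix (Fin 3) (Fin 3) K) *ᵥ (fun i => (y₁ i : K)) = (A : Matrix (Fin 3) (Fin 3) K) *ᵥ Pi.single i₀ 1 := by rw [h1M, Matrix.one_mulVec]
  have hy₂ : (((1 : unitaryGroupOfForm σ ((StdForm.antidiagonal 3).over K)) : GL (Fin 3) K) : Matrix (Fin 3) (Fin 3) K) *ᵥ (fun i => (y₂ i : K)) = (ϖ ^ s' • ((A : Matrix (Fin 3) (Fin 3) K) *ᵥ Pi.single k 1)) := by rw [h1M, Matrix.one_mulVec]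
  have hy₁a : ¬ Valued.v (B₀ σ 3 (fun i => (y₁ i : K)) (fun i => (y₁ i : K))) < 1 := by
    rw [hy₁c, ← pairing_antidiagonal, hgram, Matrix.diagonal_apply_eq, map_mul, hκv, hd, one_mul]
    exact lt_irrefl 1
  have hy₂0 : (fun i => IsLocalRing.residue 𝒪[K] (y₂ i)) = 0 := by
    funext i
    rw [Pi.zero_apply, residue_eq_zero_iff_v_lt_one]
    show Valued.v ((ϖ ^ s' • ((A : Matrix (Fin 3) (Fin 3) K) *ᵥ Pi.single k 1)) i) < 1
    rw [Pi.smul_apply, smul_eq_mul, map_mul, map_pow]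
    refine lt_of_le_of_lt (mul_le_mul' le_rfl (hAcol k i)) ?_
    rw [mul_one]; exact pow_lt_one₀ zero_le hϖ1 (by omega)
  -- `z` is primitive: `A⁻¹ z = e_j + t e_k` has `j`-coordinate `1`
  have hzu : ∃ i, Valued.v ((z i : 𝒪[K]) : K) = 1 := by
    by_contra hne
    push Not at hne
    have hlt : ∀ i, Valued.v (((A : Matrix (Fin 3) (Fin 3) K) *ᵥ Pi.single j 1 + t • ((A : Matrix (Fin 3) (Fin 3) K) *ᵥ Pi.single k 1)) i) < 1 := fun i => lt_of_le_of_ne (hzint i) (hne i)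
    have hback : (((A⁻¹ : GL (Fin 3) K) : Matrix (Fin 3) (Fin 3) K) *ᵥ ((A : Matrix (Fin 3) (Fin 3) K) *ᵥ Pi.single j 1 + t • ((A : Matrix (Fin 3) (Fin 3) K) *ᵥ Pi.single k 1))) j = 1 := by
      rw [Matrix.mulVec_add, Matrix.mulVec_smul, inv_mulVec_coe_mulVec, inv_mulVec_coe_mulVec, Pi.add_apply, Pi.smul_apply, Pi.single_eq_same,
        Pi.single_eq_of_ne hjk, smul_zero, add_zero]
    have hsum : Valued.v ((((A⁻¹ : GL (Fin 3) K) : Matrix (Fin 3) (Fin 3) K) *ᵥ ((A : Matrix (Fin 3) (Fin 3) K) *ᵥ Pi.single j 1 + t • ((A : Matrix (Fin 3) (Fin 3) K) *ᵥ Pi.single k 1))) j) < 1 := by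
      rw [Matrix.mulVec, dotProduct]
      refine Valuation.map_sum_lt _ one_ne_zero fun l _ => ?_
      rw [map_mul]
      calc Valued.v (((A⁻¹ : GL (Fin 3) K) : Matrix (Fin 3) (Fin 3) K) j l) * Valued.v (((A : Matrix (Fin 3) (Fin 3) K) *ᵥ Pi.single j 1 + t • ((A : Matrix (Fin 3) (Fin 3) K) *ᵥ Pi.single k 1)) l) ≤ 1 * Valued.v (((A : Matrix (Fin 3) (Fin 3) K) *ᵥ Pi.single j 1 + t • ((A : Matrix (Fin 3) (Fin 3) K) *ᵥ Pi.single k 1)) l) :=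
            mul_le_mul' (hA' j l) le_rfl
        _ < 1 := by rw [one_mul]; exact hlt l
    rw [hback, map_one] at hsum
    exact lt_irrefl 1 hsum
  -- `z` is isotropic to first order: `⟨z, z⟩ = κ₀ (d_j + tσ(t)d_k)`
  have hzz : pairing σ ((StdForm.antidiagonal 3).over K) ((A : Matrix (Fin 3) (Fin 3) K) *ᵥ Pi.single j 1 + t • ((A : Matrix (Fin 3) (Fin 3) K) *ᵥ Pi.single k 1)) ((A : Matrix (Fin 3) (Fin 3) K) *ᵥ Pi.single j 1 + t • ((A : Matrix (Fin 3) (Fin 3) K) *ᵥ Pi.single k 1)) =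
      (-(Matrix.diagonal d).det)⁻¹ * (d j + t * σ t * d k) := by
    rw [LinearMap.map_add₂, map_add, map_add, LinearMap.map_smulₛₗ₂, LinearMap.map_smulₛₗ₂, map_smul, map_smul, smul_eq_mul, smul_eq_mul,
      smul_eq_mul, smul_eq_mul, hgram, hgram, hgram, hgram, Matrix.diagonal_apply_eq, Matrix.diagonal_apply_eq, Matrix.diagonal_apply_ne _ hjk,
      Matrix.diagonal_apply_ne _ (Ne.symm hjk)]
    ring
  have hziso : Valued.v (B₀ σ 3 (fun i => (z i : K)) (fun i => (z i : K))) < 1 := by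
    rw [hzc, ← pairing_antidiagonal, hzz, map_mul, hκv, one_mul]
    exact htlt
  -- `z ⊥ y₁ = A e_{i₀}` (diagonal Gram)
  have hzy : Valued.v (B₀ σ 3 (fun i => (z i : K)) (fun i => (y₁ i : K))) < 1 := by
    rw [hzc, hy₁c, ← pairing_antidiagonal, LinearMap.map_add₂, LinearMap.map_smulₛₗ₂, smul_eq_mul, hgram, hgram,
      Matrix.diagonal_apply_ne _ hj, Matrix.diagonal_apply_ne _ hk, mul_zero, mul_zero, add_zero, map_zero]
    exact zero_lt_one
  -- count `2 ≠ 0` at the root (`u = 1`)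
  have hcount := ncard_adj_regDir_eq_two hσ hvσ hσϖ hϖ hres h2 A i₀ s' k (1 : unitaryGroupOfForm σ ((StdForm.antidiagonal 3).over K)) (v := ⟨stdLattice K 3, 0, isSelfDualLattice_stdLattice_three_of_v hϖ⟩) (latticeGraphIso_one_apply _).symm y₁ y₂ hy₁ hy₂ hy₁a hy₂0 z hzu hziso hzy
  obtain ⟨c, -, κ₁, hκ₁, -, hR⟩ := Set.nonempty_of_ncard_ne_zero (by rw [hcount]; norm_num)
  exact ⟨κ₁, hκ₁, hR⟩

end Literature.NumberTheory.Automorphic.UnitaryLatticeTree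

end
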